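import Mathlib
import Summits.KontsevichZagierPeriods.Zeta5Search.T1RayKit
import Summits.KontsevichZagierPeriods.Zeta5Search.FamilyCellBSplit
import HarnessLib

/-!
# ζ(5) search — the family ray at `t = 5` (`β = (23; 11,10,9,8,7,6,5)`, `d = 13`): cell B as a ZERO-REGIME type-space window, typed (HONEST FRAMING: systematic search; no irrationality claim unless certified)

Cell `pub-zeta5`, GEN-2 seat generation 19.  The `t = 5` member of census g11's consecutive family `bFam t n = n·(3t+8; t+6,…,t)` is
the ray `n·(23; 11, 10, 9, 8, 7, 6, 5)` = `bRay βB5 n` of `T1RayKit` (an arithmetic progression, but the general ray kit is what the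
window machines consume).  Its cell B, primes `6n < p < 13n/2`, is the one slice of `CellAtlas.FamilyCellB` outside the affine
mechanism of `AtlasCellRecB` (REPORT-gen2-g9 §9; P1 g8 README: the maximal pole order there is `6`, one below the affine level):
gen-2 g19's exact probe (`g19/famB_probe.py`, census-g27 ladder with the tree's rungs by name) finds that `TypeSpaceLawZero`
(a THEOREM, `ResidueLaw.typeSpaceLawZero_holds`) with `M = 6` gives the cell's truth `−6 = 6 − 2M` at every tested instance, and the
class scan (`g19/oscan.py 6 13/2 6 120`: every odd `p` with `6n < p ≤ 13n/2`, `n ≤ 120`, 1 830 instances; literal tree predicate + degree budget +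
pigeonhole by `g19/t1rays/zover.py` at the 866 primes `6n < p ≤ 13n/2` with `n ≤ 150`; 0 failures) finds the class structure

* deep classes (`E = −6`): the single palindromic type `DzB5 = [[0,−6,0]]`, never through the centre;
* `E = −5` classes: the single raises `[1,−6,0]`, `[0,−6,1]`, `[0,−5,0]` (the last one the even-centre satellite, `n` even) and ONE extra
  conjugate pair `SzB5 = [[1,−5,−1]]` (conjugate `[−1,−5,1]`) — two point values, so the affine collinearity is the pigeonhole;
* degree budget `4p ≤ 26n + 1` from `2p < 13n`.

Typed here: the ray and its four facts, the zero-regime reduction, the `@[conjecture]` class-structure node `FamB5ZeroClassesZ6` with the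
PROVED reduction `famB5WindowZ6_of` to the window bound `FamB5WindowZ6` (`−6`), a kernel instance by `decide`, and the bridge to the family
statement: `bFam 5 n = bRay βB5 n`, hence `FamB5WindowZ6 → FamilyTiers.FamilyCellBAt5` (`familyCellBAt5_of_window`).  The class structure for
all `n` is the window machine's (`FamB5Z6*.lean`, gen-2 g19 fork `g19/t1gen` of g16's `t1gen`).  `p`-adic bookkeeping of rational numbers along
residue classes; nothing here bears on irrationality.
-/

noncomputable section

open Finset

namespace Summit.KontsevichZagierPeriods.Zeta5Search.T1Rays

open Summit.KontsevichZagierPeriods.Zeta5Search.CasoratianValuation (InPolytope shift casoratian)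
open Summit.KontsevichZagierPeriods.Zeta5Search.ClusterValuation
open Summit.KontsevichZagierPeriods.Zeta5Search.SecondOrder
open Summit.KontsevichZagierPeriods.Zeta5Search.ResidueLaw
open Summit.KontsevichZagierPeriods.Zeta5Search.WedgeDictionary (dOf)
open Summit.KontsevichZagierPeriods.Zeta5Search.ZeroWindows (ZeroWindowClasses)
open Summit.KontsevichZagierPeriods.Zeta5Search.CellAtlas (bFam)
open Summit.KontsevichZagierPeriods.Zeta5Search.FamilyTiers (FamilyCellBAt5)

/-! ## §1 The ray and its four facts -/

/-- The family direction at `t = 5`: `β = (23; 11, 10, 9, 8, 7, 6, 5)`, `d = 3·23 − 56 = 13`. -/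
def βB5 : List ℤ := [23, 11, 10, 9, 8, 7, 6, 5]

/-- `b₀ = 23n`. -/
theorem famB5_zero (n : ℕ) : bRay βB5 n 0 = ((23 * n : ℕ) : ℤ) := by
  simp [bRay, βB5, mul_comm]

/-- The ray lies in the polytope. -/
theorem inPolytope_famB5 (n : ℕ) : InPolytope (bRay βB5 n) := by
  refine ⟨⟨?_, ?_⟩, ?_, ?_⟩
  · simp [bRay, βB5]
  · intro j hj
    simp only [Finset.mem_range] at hj
    interval_cases j <;> simp [bRay, βB5] <;> omega
  · intro i hi
    simp only [Finset.mem_range] at hi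
    interval_cases i <;> simp [bRay, βB5] <;> omega
  · simp [bRay, βB5, Finset.sum_range_succ]; omega

/-- Its `e₇`-shift lies in the polytope (`n ≥ 1`). -/
theorem inPolytope_shift_famB5 {n : ℕ} (hn : 1 ≤ n) : InPolytope (shift (bRay βB5 n) 7) := by
  refine ⟨⟨?_, ?_⟩, ?_, ?_⟩
  · simp [shift, bRay, βB5]
  · intro i hi
    simp only [Finset.mem_range] at hi
    interval_cases i <;> simp [shift, bRay, βB5, Function.update] <;> omega
  · intro i hi
    simp only [Finset.mem_range] at hi
    interval_cases i <;> simp [shift, bRay, βB5, Function.update] <;> omega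
  · simp [shift, bRay, βB5, Function.update, Finset.sum_range_succ]; omega

/-- `d = 13n` on the `t = 5` family ray. -/
theorem dOf_famB5 (n : ℕ) : dOf (bRay βB5 n) = 13 * (n : ℤ) := by
  simp [dOf, bRay, βB5, Finset.sum_range_succ]; ring

/-- **The bridge to the family**: `bFam 5 n` is the ray `bRay βB5 n`. -/
theorem bFam_five_eq_bRay (n : ℕ) : bFam 5 n = bRay βB5 n := by
  funext i
  rcases i with _ | _ | _ | _ | _ | _ | _ | _ | i <;> simp [bFam, bRay, βB5]

/-- The ZERO-regime reduction on the `t = 5` family ray (`b₀ = 23n`, DEG `p(M − 2) ≤ 26n + 1`). -/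
theorem famB5Zero_of_classes (n p M : ℕ) (D S : List (List ℤ)) (hn : 1 ≤ n) (hp : p.Prime) (h5 : 5 ≤ p) (hpn : p ≤ 23 * n)
    (hp2 : 23 * n + 2 < p ^ 2) (hM : 6 ≤ M) (hMe : Even M) (hdeg : (p : ℤ) * ((M : ℤ) - 2) ≤ 26 * n + 1)
    (hD : ∀ T ∈ D, T.reverse = T) (hlen : D.length + S.length ≤ 2) (hC : ZeroWindowClasses (bRay βB5 n) p M D S)
    (hne : casoratian (bRay βB5 n) 7 ≠ 0) : (6 : ℤ) - 2 * M ≤ padicValRat p (casoratian (bRay βB5 n) 7) :=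
  zeroWindow_of_classes (bRay βB5 n) (23 * n) (13 * n) p M D S (inPolytope_famB5 n) (inPolytope_shift_famB5 hn) (famB5_zero n)
    (dOf_famB5 n) hp h5 hpn hp2 hM hMe (by omega) hD hlen hC hne

/-! ## §2 The lists, the window statement, the class-structure node and the PROVED reduction -/

/-- Cell B at `t = 5` (`M = 6`): the deep palindromic type of exponent `−6`. -/
def DzB5 : List (List ℤ) := [[0, -6, 0]]

/-- Cell B at `t = 5` (`M = 6`): the extra conjugate pair of exponent `−5` (one member). -/
def SzB5 : List (List ℤ) := [[1, -5, -1]]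

/-- **FAMILY-RAY-`t = 5` WINDOW `θ = p/n ∈ (6, 13/2)`** (zero law with `M = 6`): `v_p(Cas₇(b(n))) ≥ −6 = 6 − 2M`. -/
@[conjecture] def FamB5WindowZ6 : Prop :=
  ∀ n p : ℕ, 2 ≤ n → p.Prime → 6 * n < p → 2 * p < 13 * n → casoratian (bRay βB5 n) 7 ≠ 0 →
    (-6 : ℤ) ≤ padicValRat p (casoratian (bRay βB5 n) 7)

/-- **CLASS STRUCTURE, family ray `t = 5`, cell B `(6, 13/2)`, `M = 6`** (`6n < p`, `2p < 13n`): deep palindrome `DzB5`, extra pair `SzB5`; every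
odd `p` with `6n < p ≤ 13n/2`, `n ≤ 120` (1 830 instances) and every such prime with `n ≤ 150` (866), 0 failures; all `n`: `FamB5Z6.lean`. -/
@[conjecture] def FamB5ZeroClassesZ6 : Prop :=
  ∀ n p : ℕ, 2 ≤ n → p.Prime → 6 * n < p → 2 * p < 13 * n → ZeroWindowClasses (bRay βB5 n) p 6 DzB5 SzB5

/-- **`FamB5WindowZ6` from its class structure.** -/
theorem famB5WindowZ6_of (hC : FamB5ZeroClassesZ6) : FamB5WindowZ6 := by
  intro n p hn hp h1 h2 hne
  have h13 : 13 ≤ p := by omega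
  have hp2 : 23 * n + 2 < p ^ 2 := by
    have := Nat.mul_le_mul_right p h13
    rw [pow_two]; omega
  exact famB5Zero_of_classes n p 6 DzB5 SzB5 (by omega) hp (by omega) (by omega) hp2 (by norm_num) (by decide)
    (by push_cast; omega) (by decide) (by decide) (hC n p hn hp h1 h2) hne

/-- **The `t = 5` slice of `FamilyCellB` from the window.** -/
theorem familyCellBAt5_of_window (hW : FamB5WindowZ6) : FamilyCellBAt5 := by
  intro n p hn hp h1 h2 hne
  rw [bFam_five_eq_bRay] at hne ⊢
  exact hW n p hn hp h1 h2 hne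

/-- Hence the `t = 5` slice from the class structure alone. -/
theorem familyCellBAt5_of_classes (hC : FamB5ZeroClassesZ6) : FamilyCellBAt5 :=
  familyCellBAt5_of_window (famB5WindowZ6_of hC)

/-! ## §3 Kernel instances at the first window primes, and the unconditional bounds there -/

/-- Cell B at `t = 5`, first instance `(n, p) = (3, 19)`. -/
theorem famB5_Z6_3_19 : ZeroWindowClasses (bRay βB5 3) 19 6 DzB5 SzB5 := by decide

/-- Cell B at `t = 5`, second instance `(n, p) = (5, 31)`. -/
theorem famB5_Z6_5_31 : ZeroWindowClasses (bRay βB5 5) 31 6 DzB5 SzB5 := by decide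

/-- Unconditionally: `v₁₉(Cas₇(bFam 5 3)) ≥ −6`. -/
theorem famB5_cas_3_19 (hne : casoratian (bFam 5 3) 7 ≠ 0) : (-6 : ℤ) ≤ padicValRat 19 (casoratian (bFam 5 3) 7) := by
  rw [bFam_five_eq_bRay] at hne ⊢
  have h := famB5Zero_of_classes 3 19 6 DzB5 SzB5 (by norm_num) (by norm_num) (by norm_num) (by norm_num) (by norm_num)
    (by norm_num) (by decide) (by norm_num) (by decide) (by decide) famB5_Z6_3_19 hne
  simpa using h

end Summit.KontsevichZagierPeriods.Zeta5Search.T1Rays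

end
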